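/-
Copyright (c) 2026 the pub-hodgecm-mathlib formalisation cell (harness21).  Prover seat hodgecm-mathlib-K2Liu-p08 (g5), Track B «K2-LIT»,
#184♮ = hLiu418 = `stmt-HodgeConjecture-24832`; #42S organ S1, SPLIT HAND: THE `hmid` ROWS OF ★ `K2LiuLocalSWSpanningSplitOfMoverMiddleRowsGeneral`
PAID OVER THE (C3) LEVI ROW — the split middle rows `F_{Φ_k}(w₁x) = K·g(x)`, `F_{Φ_{k+1}}(w₁x) = K·q_v⁻²·g(x)` for every `x ∈ P_Δ`, at the Cayley∕frame implementer
`E′_ε = π(frameMp_{PD} j̃(p₁,p₂))` of the (C2b′) block data.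
-/
import Summits.HodgeConjecture.HodgeConjecture.Theorems.K2LiuTensorMiddleCellLeviRow            -- ★ (C3) the Levi row (K2Liu-p26)
import Summits.HodgeConjecture.HodgeConjecture.Theorems.K2LiuTensorMiddleCellPointReading       -- ★ (C3-e) `exists_pointReading` (K2Liu-p26)
import Summits.HodgeConjecture.HodgeConjecture.Theorems.K2LiuTensorMiddleCellPhaseTrace         -- ★ (C3-d) `halfForm_cOfFix_boxConj_eq_half_im_trace` (p08)
import Summits.HodgeConjecture.HodgeConjecture.Theorems.K2LiuTensorMiddleCellFrameReading       -- ★ (C3-c) `leviLetter_inv` (K2E1-p10)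
import Summits.HodgeConjecture.HodgeConjecture.Theorems.K2LiuSymplecticLeviOfFixedLagrangians   -- ★ (C3-b) `exists_conj_iotaD_tensorEmbLoc_eq_transportSp_levi` (K2Liu-p23)
import Summits.HodgeConjecture.HodgeConjecture.Theorems.K2LiuTensorMiddleCellSiegelLetters      -- ★ `exists_nElem_mul_mem_leviDeltaLoc`, `exists_blockSkew` (p08)
import Summits.HodgeConjecture.HodgeConjecture.Theorems.K2LiuSplitWitnessLeviRowPoint           -- ★ `splitReading_at_leviRow_point` (p08)
import Summits.HodgeConjecture.HodgeConjecture.Theorems.K2LiuMiddleCellPhaseScalar              -- ★ `neg_half_im_two_mul_trace_single_entry` (p08)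
import Summits.HodgeConjecture.HodgeConjecture.Theorems.K2LiuSplitWitnessMiddleProfileRow       -- ★ `splitMiddleRows_of_leviRow_reading` (p08)
import Summits.HodgeConjecture.HodgeConjecture.Theorems.K2LiuLocalRingPlaceDecomposition        -- ★ (R4) `exists_addHaar_eq_smul_map` (F0P2-p07)
import Summits.HodgeConjecture.HodgeConjecture.Theorems.K2LiuWitnessLeviReading                 -- ★ `exists_row_exponent` (F0P2-p07)
import Literature.NumberTheory.Automorphic.UnitaryGroupSplitPlaceVolume                       -- ★ `residueFieldCard_adicCompletion_cast_eq_absNorm_under`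
import Literature.NumberTheory.Automorphic.AdelicSecondCountable                               -- ★ `secondCountableTopology_adicCompletion`
import HarnessLib

/-!
# Crux `HLiu418`, #42S organ S1, SPLIT HAND: THE SPLIT `hmid` ROWS OVER THE (C3) LEVI ROW

Cell `hodgecm-mathlib`, crux item hLiu418 = `stmt-HodgeConjecture-24832`; squad K2 ∕ K2Liu; LEAD F0P6-plan (g14); prover K2Liu-p08 (g5).
THEOREMS ONLY (no `def`, no instance, no notation, no named-fact hypothesis, no `sorry`); lane `--supports stmt-HodgeConjecture-24832 --as helper`.

WHAT.  ★ `K2LiuLocalSWSpanningSplitOfMoverMiddleRowsGeneral.localDegPS_le_localSWImage_record_of_moverMiddleRows_general` closes the split S1 face of record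
modulo ONE hypothesis `hmid`, universally quantified over the split witness data `(P₃, κ, Φ_k, Φ_{k+1}, κ′)` of ★ ED. 5 and its letters: the two middle rows
`F_{Φ_k}(w₁ · x) = K · g(x)`, `F_{Φ_{k+1}}(w₁ · x) = K · q_v⁻² · g(x)` for EVERY `x ∈ P_Δ`.  THIS FILE PAYS THOSE ROWS at the frame∕Cayley implementer
`E′_ε := π(frameMp_{PD} j̃(p₁, p₂))`, `Γ := op(frameMp_{PD} j̃(p₁, p₂))` of the (C2b′) block data (`σ, P, PD, T₁ = diag t₁, T₂`, Cayley-type `p₁`, mover `p₂`),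
given the `∇`-row letters `hEY`, `hEW` of `E′_ε` (→ (C2c)) BY VALUE:
* §1 `frameGram_single_entry` — at a point whose `Δ⁻`-reading is the single row `i₀` with entries `r`, the frame Gram `G̃ = R · 𝕋′ · Rᴴ` has the single entry
  `Q = u₀σu₁ + u₁σu₀ + u₂σu₂`, `u = r ᵥ* P₃⁻¹` (the frame letter `hP₃ : P₃ 𝕋′ᵀ (σP₃)ᵀ = [[0,1,0],[1,0,0],[0,0,1]]`);
* §2 **`exists_splitMiddleRows_of_leviRow`** — the `hmid` rows.  PROOF = the (C3) chain, one brick per step: every `x ∈ P_Δ` is `n(t)·m`, `m ∈ M_Δ` (★ Siegel letters §1),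
  block skew `tb` (§2), `B` with `hB` (★ (C3-b)); ★ (C3) reads `F_Ψ(w₁ · n(t) · m) = c · χ(m) · |det B|^{-½} · ∫ ψ_v(−½⟨y, c_{tb} y⟩)(ΓΨ)(B⁻¹·PD·y)`; the phase is
  `ψ_v(−½ im 2tr(𝕋₀ t G̃(PD y)))` (★ (C3-d)), `G̃(PD y)` is single-entry (★ (C3-e) + §1), so the phase is `ψ_v(s_t · q) = Ψ_{s_t}(u₀′u₁″ + u₀″u₁′ + u₂′u₂″)`
  (★ phase scalar + ★ `phase_eq_of_toLocalRing_eq`); the witness factor is `𝟙_{B₁} − 𝟙_{B₂}` at `κ′(B⁻¹ PD y)` = the six-block split Levi row (★ `splitReading_at_leviRow_point`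
  over ★ (C3-c) `leviLetter_inv`); the reading `y ↦ (u′, u″)` is an additive homeomorphism `X ≃ K⁶` (★ (C3-e) `cX` ∘ ★ `exists_homeomorph_vecMul` ∘ ★ `exists_homeomorph_reading3`)
  so `μ_K^{⊗6} = c_R · e_*μ^{⊗6}` (★ (R4)); ★ `splitMiddleRows_of_leviRow_reading` then gives the rows with `K = c` and `q_{w₀} = q_v` (★ split residue degree one).
References: [Kudla1994] §3 Thm. 3.1; [HarrisKudlaSweet1996] §1 (1.11), (1.15)–(1.16), §4 (4.6)–(4.9), §6 Prop. 6.4; [Rangarao1993] Lemma 3.2 (3.8), Thm. 4.2;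
[MoeglinVignerasWaldspurger1987] Chap. 2 II.1–II.6; [Weil1964] n° 13–14, 32; [CasselsFrohlichANT1967] Ch. II §10.
HONEST LABEL.  Count-neutral helper: `HC_CM` is proved only modulo the 7 printed citations (2 remaining named inputs: hLiu418 = `stmt-HodgeConjecture-24832`,
h413 = `stmt-HodgeConjecture-24833`) until rung 0 closes.  NOT here: the (C2c) letters `hEY`, `hEW`, `hprof` of `E′_ε` and the closing face.

## References
* [Kudla1994] S. S. Kudla, Israel J. Math. 87 (1994), §3 Thm. 3.1.  * [Weil1964] A. Weil, Acta Math. 111 (1964), n° 13–14, 32.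
* [HarrisKudlaSweet1996] M. Harris, S. Kudla, W. J. Sweet, J. Amer. Math. Soc. 9 (1996), §1, §4, §6.  * [Rangarao1993] R. Ranga Rao, Pacific J. Math. 157 (1993).
* [MoeglinVignerasWaldspurger1987] C. Mœglin, M.-F. Vignéras, J.-L. Waldspurger, LNM 1291 (1987), Chap. 2.  * [CasselsFrohlichANT1967] Ch. II §10.
-/

set_option autoImplicit false
set_option linter.dupNamespace false -- the mandated namespace repeats `HodgeConjecture.HodgeConjecture`

noncomputable section

open scoped Matrix Kronecker NNReal ENNReal
open NumberField IsDedekindDomain MeasureTheory Matrix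
open Literature.RepresentationTheory.HeisenbergGroup Literature.RepresentationTheory.HeisenbergGroup.SymplecticMatrix
open Literature.NumberTheory.Automorphic Literature.NumberTheory.Automorphic.UnitaryGroup Literature.NumberTheory.Weil1964
open Literature.NumberTheory.Automorphic.UnitaryGroup.QuadraticCoordinates
open Literature.NumberTheory.GaloisRepresentations Literature.NumberTheory.GaloisRepresentations.IsNonarchimedeanLocalField
open Literature.RepresentationTheory.HarrisKudlaSweet1996
open Literature.NumberTheory.GelbartRogawski1991 Literature.NumberTheory.GelbartRogawski1991.GRConstruction
open Literature.NumberTheory.GelbartRogawski1991.AdaptedBlocks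
open Literature.NumberTheory.GelbartRogawski1991.UnitaryDualPair
open Literature.NumberTheory.GelbartRogawski1991.UnitaryDualPair.LocalSplitting
open Literature.NumberTheory.GelbartRogawski1991.UnitaryDualPair.LocalSplitting.FrameTransport
open Literature.NumberTheory.GelbartRogawski1991.UnitaryDualPair.LocalSplitting.DoubledBlock
open Literature.NumberTheory.K2Lit.SiegelDoubled Literature.NumberTheory.K2Lit.LocalSiegelDoubled
open Summit.HodgeConjecture.HodgeConjecture.Cruxes.HLiu418.K2LiuLocalSWSectionDefs
open Summit.HodgeConjecture.HodgeConjecture.Cruxes.HLiu418.K2LiuLocalSWTensorAdaptedBlocks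
open Summit.HodgeConjecture.HodgeConjecture.Cruxes.HLiu418.K2LiuLocalSWTensorBlockTransport
open Summit.HodgeConjecture.HodgeConjecture.Cruxes.HLiu418.K2LiuLocalSWTensorBlockFrame
open Summit.HodgeConjecture.HodgeConjecture.Cruxes.HLiu418.K2LiuLocalSWTensorBigCellLetters
open Summit.HodgeConjecture.HodgeConjecture.Cruxes.HLiu418.K2LiuLocalSWTensorMiddleCellTransport
open Summit.HodgeConjecture.HodgeConjecture.Cruxes.HLiu418.K2LiuTensorMiddleCellHaarDelta
open Summit.HodgeConjecture.HodgeConjecture.Cruxes.HLiu418.K2LiuTensorMiddleCellLeviRow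
open Summit.HodgeConjecture.HodgeConjecture.Cruxes.HLiu418.K2LiuTensorMiddleCellPointReading
open Summit.HodgeConjecture.HodgeConjecture.Cruxes.HLiu418.K2LiuTensorMiddleCellPhaseTrace
open Summit.HodgeConjecture.HodgeConjecture.Cruxes.HLiu418.K2LiuTensorMiddleCellFrameReading
open Summit.HodgeConjecture.HodgeConjecture.Cruxes.HLiu418.K2LiuSymplecticLeviOfFixedLagrangians
open Summit.HodgeConjecture.HodgeConjecture.Cruxes.HLiu418.K2LiuTensorMiddleCellSiegelLetters
open Summit.HodgeConjecture.HodgeConjecture.Cruxes.HLiu418.K2LiuSplitWitnessLeviRowPoint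
open Summit.HodgeConjecture.HodgeConjecture.Cruxes.HLiu418.K2LiuMiddleCellPhaseScalar
open Summit.HodgeConjecture.HodgeConjecture.Cruxes.HLiu418.K2LiuSplitWitnessMiddleProfileRow
open Summit.HodgeConjecture.HodgeConjecture.Cruxes.HLiu418.K2LiuSplitMiddleProfileTransport
open Summit.HodgeConjecture.HodgeConjecture.Cruxes.HLiu418.K2LiuLocalRingPlaceDecomposition
open Summit.HodgeConjecture.HodgeConjecture.Cruxes.HLiu418.K2LiuWitnessLeviReading
open Summit.HodgeConjecture.HodgeConjecture.Cruxes.HLiu418.K2LiuA7ValueInstanceDefs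
open Summit.HodgeConjecture.HodgeConjecture.Cruxes.HLiu418.K2LiuSiegelLeviWeylAlgebra

namespace Summit.HodgeConjecture.HodgeConjecture.Cruxes.HLiu418.K2LiuSplitWitnessMiddleProfileRowOfLeviRow

/-! ## §1 The frame Gram at a single-row reading -/

section Frame

variable {F : Type} [Field F] [NumberField F] (E : Type) [Field E] [NumberField E] [Algebra F E] (c : E ≃ₐ[F] E) (v : HeightOneSpectrum (𝓞 F))

/-- **THE FRAME GRAM AT A SINGLE-ROW READING**: if `R j l = [j = i₀] · r l` and the frame `P₃` satisfies `P₃ · 𝕋′ᵀ · (σP₃)ᵀ = [[0,1,0],[1,0,0],[0,0,1]]` (the ED. 5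
letter `hP₃`), then `G̃ j i := Σ_k Σ_l R j l · 𝕋′ k l · σ(R i k)` is the single-entry matrix `[j = i = i₀] · (u₀σu₁ + u₁σu₀ + u₂σu₂)`, `u := r ᵥ* P₃⁻¹`.
[cite: Kudla1994, §3 Thm. 3.1] [cite: HarrisKudlaSweet1996, §1 (1.15)] -/
theorem frameGram_single_entry (T : Matrix (Fin 3) (Fin 3) (LocalRing E v)) (P₃ : Matrix (Fin 3) (Fin 3) (LocalRing E v)) (hP₃det : IsUnit P₃.det)
    (hP₃ : P₃ * Tᵀ * (P₃.map (conjLocal E c v))ᵀ = !![0, 1, 0; 1, 0, 0; 0, 0, 1])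
    (Rd : Fin 2 → Fin 3 → LocalRing E v) (i₀ : Fin 2) (r : Fin 3 → LocalRing E v) (hR : ∀ j l, Rd j l = if j = i₀ then r l else 0) (j i : Fin 2) :
    (Matrix.of fun j i => ∑ k, ∑ l, Rd j l * T k l * conjLocal E c v (Rd i k)) j i =
      if j = i₀ ∧ i = i₀ then
        (r ᵥ* P₃⁻¹) 0 * conjLocal E c v ((r ᵥ* P₃⁻¹) 1) + (r ᵥ* P₃⁻¹) 1 * conjLocal E c v ((r ᵥ* P₃⁻¹) 0) +
          (r ᵥ* P₃⁻¹) 2 * conjLocal E c v ((r ᵥ* P₃⁻¹) 2)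
      else 0 := by
  rw [Matrix.of_apply]
  by_cases hj : j = i₀
  · by_cases hi' : i = i₀
    · rw [if_pos ⟨hj, hi'⟩]
      subst hj; subst hi'
      simp only [hR, if_true]
      -- `r = u ᵥ* P₃`
      set u : Fin 3 → LocalRing E v := r ᵥ* P₃⁻¹ with hu
      have hr : r = u ᵥ* P₃ := by rw [hu, Matrix.vecMul_vecMul, Matrix.nonsing_inv_mul _ hP₃det, Matrix.vecMul_one]
      -- `Σ_k Σ_l r_l T_kl σ r_k = (r ᵥ* Tᵀ) ⬝ᵥ σr = u ⬝ᵥ ((P₃ Tᵀ (σP₃)ᵀ) *ᵥ σu)`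
      have h1 : (∑ k, ∑ l, r l * T k l * conjLocal E c v (r k)) = (r ᵥ* Tᵀ) ⬝ᵥ (fun k => conjLocal E c v (r k)) := by
        simp only [dotProduct, Matrix.vecMul, Matrix.transpose_apply, Finset.sum_mul]
      have hσr : (fun k => conjLocal E c v (r k)) = (fun k => conjLocal E c v (u k)) ᵥ* P₃.map (conjLocal E c v) := by
        funext k
        rw [hr]
        exact RingHom.map_vecMul (conjLocal E c v) P₃ u k
      rw [h1, hσr, hr, Matrix.vecMul_vecMul, ← Matrix.mulVec_transpose (P₃.map (conjLocal E c v)), Matrix.dotProduct_mulVec,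
        Matrix.vecMul_vecMul, hP₃]
      simp [Matrix.vecMul, dotProduct, Fin.sum_univ_three]
      ring
    · rw [if_neg (fun h => hi' h.2)]
      exact Finset.sum_eq_zero fun k _ => Finset.sum_eq_zero fun l _ => by rw [hR i k, if_neg hi', map_zero, mul_zero]
  · rw [if_neg (fun h => hj h.1)]
    exact Finset.sum_eq_zero fun k _ => Finset.sum_eq_zero fun l _ => by rw [hR j l, if_neg hj, zero_mul, zero_mul]

end Frame

/-! ## §2 The split `hmid` rows over the (C3) Levi row -/

section Tensor

variable (L : Type) [Field L] [NumberField L] [IsCMField L]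
variable {N M : ℕ} (e : Fin N × Fin M ≃ Fin 2)
  (dV : Fin N → L) (hdV : ∀ i, IsCMField.complexConj L (dV i) = dV i)
  (dW : Fin M → L) (hdW : ∀ i, IsCMField.complexConj L (dW i) = dW i)
variable {M' : ℕ} (eW : Fin M × Fin 3 ≃ Fin M') (e' : Fin N × Fin M' ≃ Fin (3 + 3))
  (dV' : Fin 3 → L) (hdV' : ∀ k, IsCMField.complexConj L (dV' k) = dV' k)
  (v : HeightOneSpectrum (𝓞 (Fp L)))
  [MeasurableSpace (v.adicCompletion (Fp L))] [BorelSpace (v.adicCompletion (Fp L))]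
  (μ : Measure (v.adicCompletion (Fp L))) [μ.IsAddHaarMeasure]
  (χ : HeckeCharacter L) (hχ : IsSplittingChar L 1 χ)

set_option maxHeartbeats 4000000 in -- MEASURED: as ★ (C3) ∕ ★ (C2b′) — the (C2b′) instance at `obtain` times out below 1600000
/-- **THE SPLIT `hmid` ROWS OVER THE (C3) LEVI ROW.**  Data: the (C2b′)∕(C3) block data at `M₂ = 3` (frame `σ, P, PD`, `T₁ ⊕ᶠ T₂ = diagonal t′`, flip `w₁` of line
`i₀`, `T₁ = diagonal t₁`, Cayley-type `p₁` (`hW₁`), mover `p₂`, conductor exponent `m`, outer mover-implementer `m₀`), a SPLIT place `w₀ ∣ v` with uniformiser `π`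
and depth `kd`, the `∇`-row letters `hEY`, `hEW` of `E′_ε := π(frameMp_{PD} j̃(p₁,p₂))` BY VALUE, and split witness data `(P₃, κ, Φ_k, Φ_{k+1}, κ′)` with the
letters `hP₃det`, `hP₃`, (K1) `hK1` (relative to `E′_ε`), the split reading `hκ′`, and the two indicator letters `hreadk`, `hreadk1` (relative to
`Γ := op(frameMp_{PD} j̃(p₁,p₂))`).  Conclusion: `∃ g K, K ≠ 0 ∧ (∀ x ∈ P_Δ, F_{Φ_k}(w₁x) = K g x) ∧ (∀ x ∈ P_Δ, F_{Φ_{k+1}}(w₁x) = K q_v⁻² g x)` — the `hmid`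
binder of ★ `localDegPS_le_localSWImage_record_of_moverMiddleRows_general` at `(E′, Γ) := (E′_ε, op)`.
[cite: Kudla1994, §3 Thm. 3.1] [cite: HarrisKudlaSweet1996, §1 (1.15)–(1.16), §4 (4.6)–(4.9), §6 Prop. 6.4] [cite: Rangarao1993, Lemma 3.2 (3.8), Thm. 4.2]
[cite: MoeglinVignerasWaldspurger1987, Chap. 2 II.1 (A), II.2, II.6] -/
theorem exists_splitMiddleRows_of_leviRow
    (hT₀d : IsUnit (gramR L e' dV hdV (tensorFrame L dW eW dV') (tensorFrame_real L dW hdW eW dV' hdV')).det)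
    {i₀ i₁ : Fin 2} (hi : i₀ ≠ i₁) {σ : Equiv.Perm (Fin (3 + 3))}
    (hσ₀ : ∀ k, σ (epsV e eW e' (i₀, k)) = finSumFinEquiv (Sum.inl k)) (hσ₁ : ∀ k, σ (epsV e eW e' (i₁, k)) = finSumFinEquiv (Sum.inr k))
    {T₁ T₂ : Matrix (Fin 3) (Fin 3) (Fp L)}
    (P : GL (Fin (3 + 3)) (Fp L)) (hPσ : (P : Matrix (Fin (3 + 3)) (Fin (3 + 3)) (Fp L)) = σ.toPEquiv.toMatrix)
    (hP : ((P : Matrix (Fin (3 + 3)) (Fin (3 + 3)) (Fp L)))ᵀ *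
        gramR L e' dV hdV (tensorFrame L dW eW dV') (tensorFrame_real L dW hdW eW dV' hdV') * (P : Matrix _ _ (Fp L)) =
      UnitaryGroup.finSum 3 3 T₁ T₂)
    (t' : Fin (3 + 3) → Fp L) (hT' : UnitaryGroup.finSum 3 3 T₁ T₂ = Matrix.diagonal t') (hT₀'d : IsUnit (UnitaryGroup.finSum 3 3 T₁ T₂).det)
    {PD : GL (Fin ((3 + 3) + (3 + 3))) (Fp L)} (hPD : PD = UnitaryGroup.reindexGL (e₂ (3 + 3)) (UnitaryGroup.blockDiagGL (P, P)))
    (m₀ : LocalMp (Fp L) ((3 + 3) + (3 + 3))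
      (gramD (Fp L) (3 + 3) (gramR L e' dV hdV (tensorFrame L dW eW dV') (tensorFrame_real L dW hdW eW dV' hdV'))) v)
    (hm₀ : (deltaLagrangian (Fp L) v (3 + 3)).map (toLin (Fp L) v (MpPsi.proj _ m₀)) = lagrangianY (Fp L) ((3 + 3) + (3 + 3)) v)
    {w₁ : UnitaryGroup.localPi L (IsCMField.complexConj L) (2 + 2) (hermD L e dV hdV dW hdW) v}
    (hw₁ : adapt (matA (Fp L) L (IsCMField.complexConj L) v 2 w₁) =
      Matrix.fromBlocks (1 - Matrix.single i₀ i₀ 1) (Matrix.single i₀ i₀ 1) (Matrix.single i₀ i₀ 1) (1 - Matrix.single i₀ i₀ 1))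
    -- the block data of (M2a-C1)
    (t₁ : Fin 3 → Fp L) (hT₁t : T₁ = Matrix.diagonal t₁) (hT₁ : T₁.IsSymm) (hT₂ : T₂.IsSymm)
    (hT₁d : IsUnit T₁.det) (hT₂d : IsUnit T₂.det)
    (hTv₁ : IsUnit (localGram (Fp L) (3 + 3) (gramD (Fp L) 3 T₁) v).det)
    (p₁ : LocalMp (Fp L) (3 + 3) (gramD (Fp L) 3 T₁) v)
    (hp₁ : (deltaLagrangian (Fp L) v 3).map (toLin (Fp L) v (MpPsi.proj _ p₁)) = lagrangianY (Fp L) (3 + 3) v)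
    (B₁ : GL (Fin (3 + 3)) (v.adicCompletion (Fp L)))
    (hW₁ : MpPsi.proj _ p₁ * iotaD (Fp L) L (IsCMField.complexConj L) (complexConj_imagUnit L) (imagUnit_ne_zero L)
        (imagUnit_mul_self L) v 3 hT₁ rfl (weylDelta (Fp L) L (IsCMField.complexConj L) v 3 (T₀ := T₁) rfl) * (MpPsi.proj _ p₁)⁻¹ =
      (transportSp (localGram (Fp L) (3 + 3) (gramD (Fp L) 3 T₁) v) hTv₁ (SymplecticGroup.symJ _ _))⁻¹ *
        transportSp (localGram (Fp L) (3 + 3) (gramD (Fp L) 3 T₁) v) hTv₁ (levi B₁))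
    {m : ℤ} (hm : (adeleAddCharAt (Fp L) v).HasConductorExp m)
    (p₂ : LocalMp (Fp L) (3 + 3) (gramD (Fp L) 3 T₂) v)
    (hp₂ : (deltaLagrangian (Fp L) v 3).map (toLin (Fp L) v (MpPsi.proj _ p₂)) = lagrangianY (Fp L) (3 + 3) v)
    -- the split place, the uniformiser, the depth
    (w₀ : PlacesOver L v) (hw₀ : IsCMField.complexConj L • w₀.1 ≠ w₀.1)
    {π : v.adicCompletion (Fp L)} (hπ : Valued.v π = WithZero.exp (-1 : ℤ)) (kd : ℕ)
    -- the `∇`-row letters of `E′_ε` ((C2c), BY VALUE)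
    (hEY : (deltaLagrangian (Fp L) v (3 + 3)).map (toLin (Fp L) v (MpPsi.proj _ (frameMp (Fp L) v ((3 + 3) + (3 + 3)) PD (transpose_pd_mul_gramD_mul_pd (Fp L) (3 + 3) P hP hPD) (boxLoc (Fp L) v 3 3 (T₁ := T₁) (T₂ := T₂) (p₁, p₂))))) = lagrangianY (Fp L) ((3 + 3) + (3 + 3)) v)
    (BW : GL (Fin ((3 + 3) + (3 + 3))) (v.adicCompletion (Fp L)))
    (hEW : haveI : Algebra.IsQuadraticExtension (Fp L) L := IsCMField.isQuadraticExtension L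
      (MpPsi.proj _ (frameMp (Fp L) v ((3 + 3) + (3 + 3)) PD (transpose_pd_mul_gramD_mul_pd (Fp L) (3 + 3) P hP hPD) (boxLoc (Fp L) v 3 3 (T₁ := T₁) (T₂ := T₂) (p₁, p₂)))) * iotaD (Fp L) L (IsCMField.complexConj L) (complexConj_imagUnit L) (imagUnit_ne_zero L) (imagUnit_mul_self L) v (3 + 3) (gramR_isSymm L e' dV hdV (tensorFrame L dW eW dV') (tensorFrame_real L dW hdW eW dV' hdV')) (hermD_eq_map_gramD L e' dV hdV (tensorFrame L dW eW dV') (tensorFrame_real L dW hdW eW dV' hdV')) (weylDelta (Fp L) L (IsCMField.complexConj L) v (3 + 3) (hermD_eq_map_gramD L e' dV hdV (tensorFrame L dW eW dV') (tensorFrame_real L dW hdW eW dV' hdV'))) * (MpPsi.proj _ (frameMp (Fp L) v ((3 + 3) + (3 + 3)) PD (transpose_pd_mul_gramD_mul_pd (Fp L) (3 + 3) P hP hPD) (boxLoc (Fp L) v 3 3 (T₁ := T₁) (T₂ := T₂) (p₁, p₂))))⁻¹ =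
        (transportSp (localGram (Fp L) ((3 + 3) + (3 + 3)) (gramD (Fp L) (3 + 3) (gramR L e' dV hdV (tensorFrame L dW eW dV') (tensorFrame_real L dW hdW eW dV' hdV'))) v) (isUnit_det_localGram_gramD (Fp L) v (3 + 3) hT₀d) (SymplecticGroup.symJ _ _))⁻¹ * transportSp (localGram (Fp L) ((3 + 3) + (3 + 3)) (gramD (Fp L) (3 + 3) (gramR L e' dV hdV (tensorFrame L dW eW dV') (tensorFrame_real L dW hdW eW dV' hdV'))) v) (isUnit_det_localGram_gramD (Fp L) v (3 + 3) hT₀d) (levi BW))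
    -- the split witness data and its letters (★ ED. 5 currency), relative to `E′_ε` and `Γ := op(frameMp j̃)`
    (P₃ : Matrix (Fin 3) (Fin 3) (LocalRing L v))
    (κ : (Fin ((3 + 3) + (3 + 3)) → v.adicCompletion (Fp L)) ≃+ ((Fin 2 → LocalRing L v) × (Fin 2 → LocalRing L v) × (Fin 2 → LocalRing L v)))
    (Φk Φk1 : SchwartzBruhat (Fin ((3 + 3) + (3 + 3)) → v.adicCompletion (Fp L)))
    (κ' : (Fin ((3 + 3) + (3 + 3)) → v.adicCompletion (Fp L)) ≃+ ((Fin 2 → w₀.1.adicCompletion L) × (Fin 2 → w₀.1.adicCompletion L) × (Fin 2 → w₀.1.adicCompletion L) × (Fin 2 → w₀.1.adicCompletion L) × (Fin 2 → w₀.1.adicCompletion L) × (Fin 2 → w₀.1.adicCompletion L)))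
    (hP₃det : IsUnit P₃.det)
    (hP₃ : P₃ * (gramS (Fp L) L v 3 (realDiagonal L dV' hdV'))ᵀ * (P₃.map (conjLocal L (IsCMField.complexConj L) v))ᵀ = !![0, 1, 0; 1, 0, 0; 0, 0, 1])
    (hK1 : ∀ (x : (Fin ((3 + 3) + (3 + 3)) → v.adicCompletion (Fp L))) (j : Fin 2), ![(κ x).1 j, (κ x).2.1 j, (κ x).2.2 j] ᵥ* P₃ = fun l => halfDiff ((eD (Fp L) L (IsCMField.complexConj L) (complexConj_imagUnit L) (imagUnit_ne_zero L) (imagUnit_mul_self L) v (3 + 3)).symm (toLin (Fp L) v (MpPsi.proj _ (frameMp (Fp L) v ((3 + 3) + (3 + 3)) PD (transpose_pd_mul_gramD_mul_pd (Fp L) (3 + 3) P hP hPD) (boxLoc (Fp L) v 3 3 (T₁ := T₁) (T₂ := T₂) (p₁, p₂))))⁻¹ (x, 0))) (epsV e eW e' (j, l)))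
    (hκ' : ∀ x : (Fin ((3 + 3) + (3 + 3)) → v.adicCompletion (Fp L)), κ' x = (fun j => conjLocal L (IsCMField.complexConj L) v ((κ x).2.1 j) w₀, fun j => (κ x).2.1 j w₀, fun j => (κ x).1 j w₀,
        fun j => conjLocal L (IsCMField.complexConj L) v ((κ x).1 j) w₀, fun j => (κ x).2.2 j w₀, fun j => conjLocal L (IsCMField.complexConj L) v ((κ x).2.2 j) w₀))
    (hreadk : ((((MpPsi.toOp _ (frameMp (Fp L) v ((3 + 3) + (3 + 3)) PD (transpose_pd_mul_gramD_mul_pd (Fp L) (3 + 3) P hP hPD) (boxLoc (Fp L) v 3 3 (T₁ := T₁) (T₂ := T₂) (p₁, p₂)))) Φk : SchwartzBruhat (Fin ((3 + 3) + (3 + 3)) → v.adicCompletion (Fp L))) : (Fin ((3 + 3) + (3 + 3)) → v.adicCompletion (Fp L)) → ℂ)) =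
        ((κ' ⁻¹' {y : ((Fin 2 → w₀.1.adicCompletion L) × (Fin 2 → w₀.1.adicCompletion L) × (Fin 2 → w₀.1.adicCompletion L) × (Fin 2 → w₀.1.adicCompletion L) × (Fin 2 → w₀.1.adicCompletion L) × (Fin 2 → w₀.1.adicCompletion L)) | (∀ i, Valued.v (y.1 i) ≤ 1) ∧ (∀ i, Valued.v (y.2.1 i) ≤ 1) ∧ (∀ i, Valued.v (y.2.2.1 i) ≤ 1) ∧ (∀ i, Valued.v (y.2.2.2.1 i) ≤ 1) ∧ (∀ i, Valued.v (y.2.2.2.2.1 i) ≤ Valued.v (toPlace v w₀ π) ^ kd) ∧ ∀ i, Valued.v (y.2.2.2.2.2 i) ≤ Valued.v (toPlace v w₀ π) ^ kd}).indicator (fun _ => (1 : ℂ)) -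
          (κ' ⁻¹' {y : ((Fin 2 → w₀.1.adicCompletion L) × (Fin 2 → w₀.1.adicCompletion L) × (Fin 2 → w₀.1.adicCompletion L) × (Fin 2 → w₀.1.adicCompletion L) × (Fin 2 → w₀.1.adicCompletion L) × (Fin 2 → w₀.1.adicCompletion L)) | ((∀ i, Valued.v (y.1 i) ≤ 1) ∧ (∀ i, Valued.v (y.2.1 i) ≤ 1) ∧ (∀ i, Valued.v (y.2.2.1 i) ≤ 1) ∧ (∀ i, Valued.v (y.2.2.2.1 i) ≤ 1) ∧ (∀ i, Valued.v (y.2.2.2.2.1 i) ≤ Valued.v (toPlace v w₀ π) ^ kd) ∧ ∀ i, Valued.v (y.2.2.2.2.2 i) ≤ Valued.v (toPlace v w₀ π) ^ kd) ∧ ((∀ i, Valued.v (y.2.1 i) ≤ Valued.v (toPlace v w₀ π)) ∧ ∀ i, Valued.v (y.1 i) ≤ Valued.v (toPlace v w₀ π))}).indicator (fun _ => (1 : ℂ))))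
    (hreadk1 : ((((MpPsi.toOp _ (frameMp (Fp L) v ((3 + 3) + (3 + 3)) PD (transpose_pd_mul_gramD_mul_pd (Fp L) (3 + 3) P hP hPD) (boxLoc (Fp L) v 3 3 (T₁ := T₁) (T₂ := T₂) (p₁, p₂)))) Φk1 : SchwartzBruhat (Fin ((3 + 3) + (3 + 3)) → v.adicCompletion (Fp L))) : (Fin ((3 + 3) + (3 + 3)) → v.adicCompletion (Fp L)) → ℂ)) =
        ((κ' ⁻¹' {y : ((Fin 2 → w₀.1.adicCompletion L) × (Fin 2 → w₀.1.adicCompletion L) × (Fin 2 → w₀.1.adicCompletion L) × (Fin 2 → w₀.1.adicCompletion L) × (Fin 2 → w₀.1.adicCompletion L) × (Fin 2 → w₀.1.adicCompletion L)) | (∀ i, Valued.v (y.1 i) ≤ 1) ∧ (∀ i, Valued.v (y.2.1 i) ≤ 1) ∧ (∀ i, Valued.v (y.2.2.1 i) ≤ 1) ∧ (∀ i, Valued.v (y.2.2.2.1 i) ≤ 1) ∧ (∀ i, Valued.v (y.2.2.2.2.1 i) ≤ Valued.v (toPlace v w₀ π) ^ (kd + 1)) ∧ ∀ i, Valued.v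 (y.2.2.2.2.2 i) ≤ Valued.v (toPlace v w₀ π) ^ (kd + 1)}).indicator (fun _ => (1 : ℂ)) -
          (κ' ⁻¹' {y : ((Fin 2 → w₀.1.adicCompletion L) × (Fin 2 → w₀.1.adicCompletion L) × (Fin 2 → w₀.1.adicCompletion L) × (Fin 2 → w₀.1.adicCompletion L) × (Fin 2 → w₀.1.adicCompletion L) × (Fin 2 → w₀.1.adicCompletion L)) | ((∀ i, Valued.v (y.1 i) ≤ 1) ∧ (∀ i, Valued.v (y.2.1 i) ≤ 1) ∧ (∀ i, Valued.v (y.2.2.1 i) ≤ 1) ∧ (∀ i, Valued.v (y.2.2.2.1 i) ≤ 1) ∧ (∀ i, Valued.v (y.2.2.2.2.1 i) ≤ Valued.v (toPlace v w₀ π) ^ (kd + 1)) ∧ ∀ i, Valued.v (y.2.2.2.2.2 i) ≤ Valued.v (toPlace v w₀ π) ^ (kd + 1)) ∧ ((∀ i, Valued.v (y.2.1 i) ≤ Valued.v (toPlace v w₀ π)) ∧ ∀ i, Valued.v (y.1 i) ≤ Valued.v (toPlace v w₀ π))}).indicator (fun _ => (1 : ℂ)))) :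
    ∃ (g : UnitaryGroup.localPi L (IsCMField.complexConj L) (2 + 2) (hermD L e dV hdV dW hdW) v → ℂ) (Kk : ℂ), Kk ≠ 0 ∧
      (∀ x ∈ siegelDeltaLoc L e dV hdV dW hdW v, swSectionTensorLoc L e dV hdV dW hdW eW e' dV' hdV' v (localSplittingDatumCM L v μ (3 + 3) (gramR_isSymm L e' dV hdV (tensorFrame L dW eW dV') (tensorFrame_real L dW hdW eW dV' hdV')) hT₀d (hermD_eq_map_gramD L e' dV hdV (tensorFrame L dW eW dV') (tensorFrame_real L dW hdW eW dV' hdV')) χ hχ).localSplitting m₀ Φk (w₁ * x) = Kk * g x) ∧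
      (∀ x ∈ siegelDeltaLoc L e dV hdV dW hdW v, swSectionTensorLoc L e dV hdV dW hdW eW e' dV' hdV' v (localSplittingDatumCM L v μ (3 + 3) (gramR_isSymm L e' dV hdV (tensorFrame L dW eW dV') (tensorFrame_real L dW hdW eW dV' hdV')) hT₀d (hermD_eq_map_gramD L e' dV hdV (tensorFrame L dW eW dV') (tensorFrame_real L dW hdW eW dV' hdV')) χ hχ).localSplitting m₀ Φk1 (w₁ * x) = (Kk * ((v.residueCard : ℂ))⁻¹ ^ 2) * g x) := by
  haveI hIQ : Algebra.IsQuadraticExtension (Fp L) L := IsCMField.isQuadraticExtension L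
  haveI : SecondCountableTopology (v.adicCompletion (Fp L)) := secondCountableTopology_adicCompletion (Fp L) v
  haveI : SecondCountableTopology (w₀.1.adicCompletion L) := secondCountableTopology_adicCompletion L w₀.1
  letI : MeasurableSpace (w₀.1.adicCompletion L) := borel _
  haveI : BorelSpace (w₀.1.adicCompletion L) := ⟨rfl⟩
  obtain ⟨μK, hμKh⟩ : ∃ μK : Measure (w₀.1.adicCompletion L), μK.IsAddHaarMeasure := ⟨Measure.addHaar, inferInstance⟩
  haveI := hμKh
  -- ★ (C3) the Levi row
  obtain ⟨c, hc, hC3⟩ := exists_ne_zero_swSectionTensorLoc_flip_mul_nElem_mul_eq_integral_levi L e dV hdV dW hdW eW e' dV' hdV' v μ χ hχ (by norm_num) hT₀d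
    hi hσ₀ hσ₁ P hPσ hP t' hT' hT₀'d hPD m₀ hm₀ hw₁ (by norm_num) t₁ hT₁t hT₁ hT₂ hT₁d hT₂d hTv₁ p₁ hp₁ B₁ hW₁ hm p₂ hp₂
  -- ★ (C3-e) the block reading of the integration point
  obtain ⟨cX, hcX⟩ := exists_pointReading L e dV hdV dW hdW eW e' dV' hdV' v hi hσ₀ hσ₁ P hPσ hP hPD p₁ hp₁ p₂
  -- per-`x` letters: `x = n(t) · m`, `m ∈ M_Δ` (★ Siegel letters §1), the block skew `tb` (§2), the Levi letter `B` of `m` (★ (C3-b))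
  have hdec : ∀ x, x ∈ siegelDeltaLoc L e dV hdV dW hdW v → ∃ (t : Matrix (Fin 2) (Fin 2) (LocalRing L v))
      (ht : (t.map (conjLocal L (IsCMField.complexConj L) v))ᵀ * gramS (Fp L) L v 2 (gramR L e dV hdV dW hdW) + gramS (Fp L) L v 2 (gramR L e dV hdV dW hdW) * t = 0)
      (m : UnitaryGroup.localPi L (IsCMField.complexConj L) (2 + 2) (hermD L e dV hdV dW hdW) v)
      (tb : Matrix (Fin (3 + 3)) (Fin (3 + 3)) (LocalRing L v)) (B : GL (Fin ((3 + 3) + (3 + 3))) (v.adicCompletion (Fp L))),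
      m ∈ leviDeltaLoc L e dV hdV dW hdW v ∧
      ((tb.map (conjLocal L (IsCMField.complexConj L) v))ᵀ * gramS (Fp L) L v (3 + 3) (UnitaryGroup.finSum 3 3 T₁ T₂) +
          gramS (Fp L) L v (3 + 3) (UnitaryGroup.finSum 3 3 T₁ T₂) * tb = 0) ∧
      ((P : Matrix (Fin (3 + 3)) (Fin (3 + 3)) (Fp L)).map ((UnitaryGroup.toLocalRing L v).comp (algebraMap (Fp L) (v.adicCompletion (Fp L)))) * tb *
          ((P⁻¹ : GL (Fin (3 + 3)) (Fp L)) : Matrix (Fin (3 + 3)) (Fin (3 + 3)) (Fp L)).map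
            ((UnitaryGroup.toLocalRing L v).comp (algebraMap (Fp L) (v.adicCompletion (Fp L)))) =
        Matrix.reindex (epsV e eW e') (epsV e eW e') (t ⊗ₖ (1 : Matrix (Fin 3) (Fin 3) (LocalRing L v)))) ∧
      ((MpPsi.proj _ (frameMp (Fp L) v ((3 + 3) + (3 + 3)) PD (transpose_pd_mul_gramD_mul_pd (Fp L) (3 + 3) P hP hPD) (boxLoc (Fp L) v 3 3 (T₁ := T₁) (T₂ := T₂) (p₁, p₂)))) * iotaD (Fp L) L (IsCMField.complexConj L) (complexConj_imagUnit L) (imagUnit_ne_zero L) (imagUnit_mul_self L) v (3 + 3) (gramR_isSymm L e' dV hdV (tensorFrame L dW eW dV') (tensorFrame_real L dW hdW eW dV' hdV')) (hermD_eq_map_gramD L e' dV hdV (tensorFrame L dW eW dV') (tensorFrame_real L dW hdW eW dV' hdV')) (tensorEmbLoc L e dV hdV dW hdW eW e' dV' hdV' v m) * (MpPsi.proj _ (frameMp (Fp L) v ((3 + 3) + (3 + 3)) PD (transpose_pd_mul_gramD_mul_pd (Fp L) (3 + 3) P hP hPD) (boxLoc (Fp L) v 3 3 (T₁ := T₁)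 (T₂ := T₂) (p₁, p₂))))⁻¹ =
        transportSp (localGram (Fp L) ((3 + 3) + (3 + 3)) (gramD (Fp L) (3 + 3) (gramR L e' dV hdV (tensorFrame L dW eW dV') (tensorFrame_real L dW hdW eW dV' hdV'))) v) (isUnit_det_localGram_gramD (Fp L) v (3 + 3) hT₀d) (levi B)) ∧
      x = nElem (Fp L) L (IsCMField.complexConj L) v 2 (T₀ := gramR L e dV hdV dW hdW) (hermD_eq_map_gramD L e dV hdV dW hdW) t ht * m := by
    intro x hx
    obtain ⟨t, ht, m, hmM, hxeq⟩ := exists_nElem_mul_mem_leviDeltaLoc L e dV hdV dW hdW v x hx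
    obtain ⟨tb, htb, hPX⟩ := exists_blockSkew L e dV hdV dW hdW v eW e' dV' hdV' P hP t ht
    obtain ⟨B, hB⟩ := exists_conj_iotaD_tensorEmbLoc_eq_transportSp_levi L e dV hdV dW hdW eW e' dV' hdV' v (isUnit_det_localGram_gramD (Fp L) v (3 + 3) hT₀d) (MpPsi.proj _ (frameMp (Fp L) v ((3 + 3) + (3 + 3)) PD (transpose_pd_mul_gramD_mul_pd (Fp L) (3 + 3) P hP hPD) (boxLoc (Fp L) v 3 3 (T₁ := T₁) (T₂ := T₂) (p₁, p₂)))) hEY BW hEW hmM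
    exact ⟨t, ht, m, tb, B, hmM, htb, hPX, hB, hxeq⟩
  choose! tF htF mF tbF BF hmM htbF hPXF hBF hxF using hdec
  -- the additive homeomorphism `X ≃ K⁶`: `y ↦ ((u₁′,u₁″),(u₂′,u₂″),(u₀′,u₀″))`, `u = cX y ᵥ* P₃⁻¹` (★ (C3-e) ∘ ★ `exists_homeomorph_vecMul` ∘ ★ `exists_homeomorph_reading3`)
  obtain ⟨Θ, hΘ, hΘadd⟩ := exists_homeomorph_reading3 (IsCMField.complexConj L) (complexConj_imagUnit L) (imagUnit_ne_zero L) v w₀ hw₀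
  obtain ⟨φ, hφ, hφadd⟩ := exists_homeomorph_vecMul (E := L) (v := v) P₃⁻¹ (Matrix.isUnit_nonsing_inv_det P₃ hP₃det)
  obtain ⟨e₀, he₀⟩ : ∃ e₀ : (Fin (3 + 3) → v.adicCompletion (Fp L)) ≃ₜ (((w₀.1.adicCompletion L) × (w₀.1.adicCompletion L)) × ((w₀.1.adicCompletion L) × (w₀.1.adicCompletion L))) × ((w₀.1.adicCompletion L) × (w₀.1.adicCompletion L)),
      ∀ y, e₀ y = Θ (φ (cX y)) := ⟨cX.toHomeomorph.trans (φ.trans Θ), fun _ => rfl⟩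
  have hadd : ∀ y y', e₀ (y + y') = e₀ y + e₀ y' := fun y y' => by rw [he₀, he₀, he₀, map_add, hφadd, hΘadd]
  haveI : (μK.prod μK).IsAddHaarMeasure := Measure.prod.instIsAddHaarMeasure _ _
  haveI : ((μK.prod μK).prod (μK.prod μK)).IsAddHaarMeasure := Measure.prod.instIsAddHaarMeasure _ _
  haveI : (((μK.prod μK).prod (μK.prod μK)).prod (μK.prod μK)).IsAddHaarMeasure := Measure.prod.instIsAddHaarMeasure _ _
  obtain ⟨cR, hcR, hμR⟩ := exists_addHaar_eq_smul_map e₀ hadd (Measure.pi fun _ : Fin (3 + 3) => μ)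
    (((μK.prod μK).prod (μK.prod μK)).prod (μK.prod μK))
  -- the phase family on `K` (★ `exists_addChar_transport`)
  obtain ⟨Ψf, hΨf, hΨc, -⟩ := exists_addChar_transport (IsCMField.complexConj L) v w₀ hw₀ (adeleAddCharAt (Fp L) v) (continuous_adeleAddCharAt (Fp L) v)
  -- the split uniformiser threshold, the rows `a′, a″` of `D = blkD (matA m⁻¹)` and their exponents
  have hπw : Valued.v (toPlace v w₀ π) = WithZero.exp (-1 : ℤ) := valued_toPlace_uniformizer_of_smul_ne (IsCMField.complexConj L) v w₀ hw₀ hπ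
  have hDu : ∀ x, x ∈ siegelDeltaLoc L e dV hdV dW hdW v → IsUnit (blkD (matA (Fp L) L (IsCMField.complexConj L) v 2 (mF x)⁻¹)).det := fun x hx =>
    (isUnit_det_blkA_blkD (Fp L) L (IsCMField.complexConj L) v 2 (JD := hermD L e dV hdV dW hdW) (inv_mem (hmM x hx)).2).2
  have hex' : ∀ x, x ∈ siegelDeltaLoc L e dV hdV dW hdW v → ∃ n : ℤ,
      (∀ j, Valued.v ((fun j => blkD (matA (Fp L) L (IsCMField.complexConj L) v 2 (mF x)⁻¹) j i₀ w₀) j) ≤ Valued.v (toPlace v w₀ π) ^ (-n)) ∧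
      ∃ j, Valued.v ((fun j => blkD (matA (Fp L) L (IsCMField.complexConj L) v 2 (mF x)⁻¹) j i₀ w₀) j) = Valued.v (toPlace v w₀ π) ^ (-n) := fun x hx =>
    exists_row_exponent (Fp L) L v w₀ hπw _ (col_reading_ne_zero (IsCMField.complexConj L) v w₀ _ (hDu x hx) i₀).1
  have hex'' : ∀ x, x ∈ siegelDeltaLoc L e dV hdV dW hdW v → ∃ n : ℤ,
      (∀ j, Valued.v ((fun j => conjLocal L (IsCMField.complexConj L) v (blkD (matA (Fp L) L (IsCMField.complexConj L) v 2 (mF x)⁻¹) j i₀) w₀) j) ≤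
        Valued.v (toPlace v w₀ π) ^ (-n)) ∧
      ∃ j, Valued.v ((fun j => conjLocal L (IsCMField.complexConj L) v (blkD (matA (Fp L) L (IsCMField.complexConj L) v 2 (mF x)⁻¹) j i₀) w₀) j) =
        Valued.v (toPlace v w₀ π) ^ (-n) := fun x hx =>
    exists_row_exponent (Fp L) L v w₀ hπw _ (col_reading_ne_zero (IsCMField.complexConj L) v w₀ _ (hDu x hx) i₀).2
  choose! n' hn'le hn'eq using hex'
  choose! n'' hn''le hn''eq using hex''
  -- `q_{w₀} = q_v` at the split place
  have hqK : ((residueFieldCard (w₀.1.adicCompletion L) : ℂ)) = (v.residueCard : ℂ) := by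
    have h := residueFieldCard_adicCompletion_cast_eq_absNorm_under (F := Fp L) (E := L) (IsCMField.complexConj L) w₀ hw₀
    have h' : residueFieldCard (w₀.1.adicCompletion L) = Ideal.absNorm v.asIdeal := by exact_mod_cast h
    rw [h']
    rfl
  -- THE ROW along the (C3) Levi row, for one indicator letter
  have hrow : ∀ (Φ : SchwartzBruhat (Fin ((3 + 3) + (3 + 3)) → v.adicCompletion (Fp L))) (kk : ℕ), ((((MpPsi.toOp _ (frameMp (Fp L) v ((3 + 3) + (3 + 3)) PD (transpose_pd_mul_gramD_mul_pd (Fp L) (3 + 3) P hP hPD) (boxLoc (Fp L) v 3 3 (T₁ := T₁) (T₂ := T₂) (p₁, p₂)))) Φ : SchwartzBruhat (Fin ((3 + 3) + (3 + 3)) → v.adicCompletion (Fp L))) : (Fin ((3 + 3) + (3 + 3)) → v.adicCompletion (Fp L)) → ℂ)) =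
        ((κ' ⁻¹' {y : ((Fin 2 → w₀.1.adicCompletion L) × (Fin 2 → w₀.1.adicCompletion L) × (Fin 2 → w₀.1.adicCompletion L) × (Fin 2 → w₀.1.adicCompletion L) × (Fin 2 → w₀.1.adicCompletion L) × (Fin 2 → w₀.1.adicCompletion L)) | (∀ i, Valued.v (y.1 i) ≤ 1) ∧ (∀ i, Valued.v (y.2.1 i) ≤ 1) ∧ (∀ i, Valued.v (y.2.2.1 i) ≤ 1) ∧ (∀ i, Valued.v (y.2.2.2.1 i) ≤ 1) ∧ (∀ i, Valued.v (y.2.2.2.2.1 i) ≤ Valued.v (toPlace v w₀ π) ^ kk) ∧ ∀ i, Valued.v (y.2.2.2.2.2 i) ≤ Valued.v (toPlace v w₀ π) ^ kk}).indicator (fun _ => (1 : ℂ)) -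
          (κ' ⁻¹' {y : ((Fin 2 → w₀.1.adicCompletion L) × (Fin 2 → w₀.1.adicCompletion L) × (Fin 2 → w₀.1.adicCompletion L) × (Fin 2 → w₀.1.adicCompletion L) × (Fin 2 → w₀.1.adicCompletion L) × (Fin 2 → w₀.1.adicCompletion L)) | ((∀ i, Valued.v (y.1 i) ≤ 1) ∧ (∀ i, Valued.v (y.2.1 i) ≤ 1) ∧ (∀ i, Valued.v (y.2.2.1 i) ≤ 1) ∧ (∀ i, Valued.v (y.2.2.2.1 i) ≤ 1) ∧ (∀ i, Valued.v (y.2.2.2.2.1 i) ≤ Valued.v (toPlace v w₀ π) ^ kk) ∧ ∀ i, Valued.v (y.2.2.2.2.2 i) ≤ Valued.v (toPlace v w₀ π) ^ kk) ∧ ((∀ i, Valued.v (y.2.1 i) ≤ Valued.v (toPlace v w₀ π)) ∧ ∀ i, Valued.v (y.1 i) ≤ Valued.v (toPlace v w₀ π))}).indicator (fun _ => (1 : ℂ))) →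
      ∀ x, x ∈ siegelDeltaLoc L e dV hdV dW hdW v → swSectionTensorLoc L e dV hdV dW hdW eW e' dV' hdV' v (localSplittingDatumCM L v μ (3 + 3) (gramR_isSymm L e' dV hdV (tensorFrame L dW eW dV') (tensorFrame_real L dW hdW eW dV' hdV')) hT₀d (hermD_eq_map_gramD L e' dV hdV (tensorFrame L dW eW dV') (tensorFrame_real L dW hdW eW dV' hdV')) χ hχ).localSplitting m₀ Φ (w₁ * x) =
        c * (((((chiDet (Fp L) L (IsCMField.complexConj L) v (3 + 3) (fun w' : PlacesOver L v => (χ.localComponent w'.1)⁻¹)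
              (tensorEmbLoc L e dV hdV dW hdW eW e' dV' hdV' v (mF x)))⁻¹ : ℂˣ) : ℂ) * ((modSqrt (glEquiv (BF x)) : ℂ))⁻¹) *
          ∫ y, ((Ψf (-(im (quadraticLocalEquiv L v (IsCMField.complexConj L) (complexConj_imagUnit L) (imagUnit_ne_zero L)).toLinearEquiv.toAddEquiv
                    ((gramS (Fp L) L v 2 (gramR L e dV hdV dW hdW) * tF x) i₀ i₀)))
                ((e₀.toMeasurableEquiv y).2.1 * (e₀.toMeasurableEquiv y).1.1.2 + (e₀.toMeasurableEquiv y).2.2 * (e₀.toMeasurableEquiv y).1.1.1 +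
                  (1 : w₀.1.adicCompletion L) * (e₀.toMeasurableEquiv y).1.2.1 * (e₀.toMeasurableEquiv y).1.2.2) : Circle) : ℂ) *
            ({y : ((Fin 2 → w₀.1.adicCompletion L) × (Fin 2 → w₀.1.adicCompletion L) × (Fin 2 → w₀.1.adicCompletion L) × (Fin 2 → w₀.1.adicCompletion L) × (Fin 2 → w₀.1.adicCompletion L) × (Fin 2 → w₀.1.adicCompletion L)) | (∀ i, Valued.v (y.1 i) ≤ 1) ∧ (∀ i, Valued.v (y.2.1 i) ≤ 1) ∧ (∀ i, Valued.v (y.2.2.1 i) ≤ 1) ∧ (∀ i, Valued.v (y.2.2.2.1 i) ≤ 1) ∧ (∀ i, Valued.v (y.2.2.2.2.1 i) ≤ Valued.v (toPlace v w₀ π) ^ kk) ∧ ∀ i, Valued.v (y.2.2.2.2.2 i) ≤ Valued.v (toPlace v w₀ π) ^ kk}.indicator (fun _ => (1 : ℂ))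
                ((fun j => (e₀.toMeasurableEquiv y).1.1.2 * conjLocal L (IsCMField.complexConj L) v (blkD (matA (Fp L) L (IsCMField.complexConj L) v 2 (mF x)⁻¹) j i₀) w₀,
                  fun j => (e₀.toMeasurableEquiv y).1.1.1 * blkD (matA (Fp L) L (IsCMField.complexConj L) v 2 (mF x)⁻¹) j i₀ w₀,
                  fun j => (e₀.toMeasurableEquiv y).2.1 * blkD (matA (Fp L) L (IsCMField.complexConj L) v 2 (mF x)⁻¹) j i₀ w₀,
                  fun j => (e₀.toMeasurableEquiv y).2.2 * conjLocal L (IsCMField.complexConj L) v (blkD (matA (Fp L) L (IsCMField.complexConj L) v 2 (mF x)⁻¹) j i₀) w₀,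
                  fun j => (e₀.toMeasurableEquiv y).1.2.1 * blkD (matA (Fp L) L (IsCMField.complexConj L) v 2 (mF x)⁻¹) j i₀ w₀,
                  fun j => (e₀.toMeasurableEquiv y).1.2.2 * conjLocal L (IsCMField.complexConj L) v (blkD (matA (Fp L) L (IsCMField.complexConj L) v 2 (mF x)⁻¹) j i₀) w₀) :
                  ((Fin 2 → w₀.1.adicCompletion L) × (Fin 2 → w₀.1.adicCompletion L) × (Fin 2 → w₀.1.adicCompletion L) × (Fin 2 → w₀.1.adicCompletion L) × (Fin 2 → w₀.1.adicCompletion L) × (Fin 2 → w₀.1.adicCompletion L))) -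
              {y : ((Fin 2 → w₀.1.adicCompletion L) × (Fin 2 → w₀.1.adicCompletion L) × (Fin 2 → w₀.1.adicCompletion L) × (Fin 2 → w₀.1.adicCompletion L) × (Fin 2 → w₀.1.adicCompletion L) × (Fin 2 → w₀.1.adicCompletion L)) | ((∀ i, Valued.v (y.1 i) ≤ 1) ∧ (∀ i, Valued.v (y.2.1 i) ≤ 1) ∧ (∀ i, Valued.v (y.2.2.1 i) ≤ 1) ∧ (∀ i, Valued.v (y.2.2.2.1 i) ≤ 1) ∧ (∀ i, Valued.v (y.2.2.2.2.1 i) ≤ Valued.v (toPlace v w₀ π) ^ kk) ∧ ∀ i, Valued.v (y.2.2.2.2.2 i) ≤ Valued.v (toPlace v w₀ π) ^ kk) ∧ ((∀ i, Valued.v (y.2.1 i) ≤ Valued.v (toPlace v w₀ π)) ∧ ∀ i, Valued.v (y.1 i) ≤ Valued.v (toPlace v w₀ π))}.indicator (fun _ => (1 : ℂ))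
                ((fun j => (e₀.toMeasurableEquiv y).1.1.2 * conjLocal L (IsCMField.complexConj L) v (blkD (matA (Fp L) L (IsCMField.complexConj L) v 2 (mF x)⁻¹) j i₀) w₀,
                  fun j => (e₀.toMeasurableEquiv y).1.1.1 * blkD (matA (Fp L) L (IsCMField.complexConj L) v 2 (mF x)⁻¹) j i₀ w₀,
                  fun j => (e₀.toMeasurableEquiv y).2.1 * blkD (matA (Fp L) L (IsCMField.complexConj L) v 2 (mF x)⁻¹) j i₀ w₀,
                  fun j => (e₀.toMeasurableEquiv y).2.2 * conjLocal L (IsCMField.complexConj L) v (blkD (matA (Fp L) L (IsCMField.complexConj L) v 2 (mF x)⁻¹) j i₀) w₀,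
                  fun j => (e₀.toMeasurableEquiv y).1.2.1 * blkD (matA (Fp L) L (IsCMField.complexConj L) v 2 (mF x)⁻¹) j i₀ w₀,
                  fun j => (e₀.toMeasurableEquiv y).1.2.2 * conjLocal L (IsCMField.complexConj L) v (blkD (matA (Fp L) L (IsCMField.complexConj L) v 2 (mF x)⁻¹) j i₀) w₀) :
                  ((Fin 2 → w₀.1.adicCompletion L) × (Fin 2 → w₀.1.adicCompletion L) × (Fin 2 → w₀.1.adicCompletion L) × (Fin 2 → w₀.1.adicCompletion L) × (Fin 2 → w₀.1.adicCompletion L) × (Fin 2 → w₀.1.adicCompletion L)))) ∂(Measure.pi fun _ : Fin (3 + 3) => μ)) := by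
    intro Φ kk hread x hx
    have hk : IsSiegelDelta (Fp L) L (IsCMField.complexConj L) (complexConj_imagUnit L) (imagUnit_ne_zero L) (imagUnit_mul_self L) v 2 (gramR_isSymm L e dV hdV dW hdW) (hermD_eq_map_gramD L e dV hdV dW hdW) (mF x) :=
      isSiegelDelta_of_mem_leviDeltaLoc L e dV hdV dW hdW v (complexConj_imagUnit L) (imagUnit_ne_zero L) (imagUnit_mul_self L)
        (gramR_isSymm L e dV hdV dW hdW) (hermD_eq_map_gramD L e dV hdV dW hdW) (hmM x hx)
    have hkinv : IsSiegelDelta (Fp L) L (IsCMField.complexConj L) (complexConj_imagUnit L) (imagUnit_ne_zero L) (imagUnit_mul_self L) v 2 (gramR_isSymm L e dV hdV dW hdW) (hermD_eq_map_gramD L e dV hdV dW hdW) (mF x)⁻¹ :=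
      isSiegelDelta_of_mem_leviDeltaLoc L e dV hdV dW hdW v (complexConj_imagUnit L) (imagUnit_ne_zero L) (imagUnit_mul_self L)
        (gramR_isSymm L e dV hdV dW hdW) (hermD_eq_map_gramD L e dV hdV dW hdW) (inv_mem (hmM x hx))
    conv_lhs => rw [hxF x hx]
    rw [hC3 (tF x) (htF x hx) (tbF x) (htbF x hx) (hPXF x hx) Φ (mF x) hk (BF x) (hBF x hx)]
    have key : ∀ (a b I J : ℂ), I = J → c * (a * (b * I)) = c * ((a * b) * J) := by
      rintro a b I J rfl
      ring
    refine key _ _ _ _ (integral_congr_ae (Filter.Eventually.of_forall fun x₁ => ?_))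
    -- the indicator letter, read through `κ′`
    dsimp only
    have hind : ∀ (s : Set ((Fin 2 → w₀.1.adicCompletion L) × (Fin 2 → w₀.1.adicCompletion L) × (Fin 2 → w₀.1.adicCompletion L) × (Fin 2 → w₀.1.adicCompletion L) × (Fin 2 → w₀.1.adicCompletion L) × (Fin 2 → w₀.1.adicCompletion L))) (z : (Fin ((3 + 3) + (3 + 3)) → v.adicCompletion (Fp L))), (⇑κ' ⁻¹' s).indicator (fun _ => (1 : ℂ)) z = s.indicator (fun _ => (1 : ℂ)) (κ' z) := fun s z =>
      Set.indicator_comp_right (g := fun _ => (1 : ℂ)) ⇑κ'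
    have hW := congrFun hread ((((BF x)⁻¹ : GL (Fin ((3 + 3) + (3 + 3))) (v.adicCompletion (Fp L))) :
        Matrix (Fin ((3 + 3) + (3 + 3))) (Fin ((3 + 3) + (3 + 3))) (v.adicCompletion (Fp L))) *ᵥ
      frameLin (Fp L) v ((3 + 3) + (3 + 3)) PD (glue (blkIdx 3 3) x₁ (0 : Fin (3 + 3) → v.adicCompletion (Fp L))))
    rw [Pi.sub_apply, hind, hind,
      splitReading_at_leviRow_point L e dV hdV dW hdW eW e' dV' hdV' v w₀ (isUnit_det_localGram_gramD (Fp L) v (3 + 3) hT₀d) (MpPsi.proj _ (frameMp (Fp L) v ((3 + 3) + (3 + 3)) PD (transpose_pd_mul_gramD_mul_pd (Fp L) (3 + 3) P hP hPD) (boxLoc (Fp L) v 3 3 (T₁ := T₁) (T₂ := T₂) (p₁, p₂)))) P₃ hP₃det (fun y => κ y) hK1 (fun y => κ' y) hκ' (mF x)⁻¹ hkinv (BF x)⁻¹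
        (leviLetter_inv L e dV hdV dW hdW eW e' dV' hdV' v (isUnit_det_localGram_gramD (Fp L) v (3 + 3) hT₀d) (MpPsi.proj _ (frameMp (Fp L) v ((3 + 3) + (3 + 3)) PD (transpose_pd_mul_gramD_mul_pd (Fp L) (3 + 3) P hP hPD) (boxLoc (Fp L) v 3 3 (T₁ := T₁) (T₂ := T₂) (p₁, p₂)))) (mF x) (BF x) (hBF x hx)) _ i₀ (cX x₁) (hcX x₁)] at hW
    rw [hW]
    -- the phase: ★ (C3-d) trace form, single-entry Gram (★ (C3-e) + §1), the scalar `s_t · q`, transport to `K`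
    have hG := frameGram_single_entry L (IsCMField.complexConj L) v (gramS (Fp L) L v 3 (realDiagonal L dV' hdV')) P₃ hP₃det hP₃ _ i₀ (cX x₁) (hcX x₁)
    have hQσ : conjLocal L (IsCMField.complexConj L) v
        ((cX x₁ ᵥ* P₃⁻¹) 0 * conjLocal L (IsCMField.complexConj L) v ((cX x₁ ᵥ* P₃⁻¹) 1) +
          (cX x₁ ᵥ* P₃⁻¹) 1 * conjLocal L (IsCMField.complexConj L) v ((cX x₁ ᵥ* P₃⁻¹) 0) +
          (cX x₁ ᵥ* P₃⁻¹) 2 * conjLocal L (IsCMField.complexConj L) v ((cX x₁ ᵥ* P₃⁻¹) 2)) =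
        (cX x₁ ᵥ* P₃⁻¹) 0 * conjLocal L (IsCMField.complexConj L) v ((cX x₁ ᵥ* P₃⁻¹) 1) +
          (cX x₁ ᵥ* P₃⁻¹) 1 * conjLocal L (IsCMField.complexConj L) v ((cX x₁ ᵥ* P₃⁻¹) 0) +
          (cX x₁ ᵥ* P₃⁻¹) 2 * conjLocal L (IsCMField.complexConj L) v ((cX x₁ ᵥ* P₃⁻¹) 2) := by
      simp only [map_add, map_mul, conjLocal_conjLocal (IsCMField.complexConj L) v (complexConj_imagUnit L) (imagUnit_ne_zero L)]
      ring
    rw [halfForm_cOfFix_boxConj_eq_half_im_trace L e dV hdV dW hdW eW e' dV' hdV' v hT₁ hT₂ P hP hPD (boxLoc (Fp L) v 3 3 (T₁ := T₁) (T₂ := T₂) (p₁, p₂))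
        (tF x) (htF x hx) (tbF x) (htbF x hx) (hPXF x hx),
      neg_half_im_two_mul_trace_single_entry (F := Fp L) L (IsCMField.complexConj L) (complexConj_imagUnit L) (imagUnit_ne_zero L) (imagUnit_mul_self L) v
        (gramR L e dV hdV dW hdW) (tF x) _ i₀ _ hQσ hG,
      phase_eq_of_toLocalRing_eq (IsCMField.complexConj L) v w₀ (adeleAddCharAt (Fp L) v) (Ψf _) (hΨf _)
        (toLocalRing_re_of_conjLocal_eq (F := Fp L) L (IsCMField.complexConj L) (complexConj_imagUnit L) (imagUnit_ne_zero L) (imagUnit_mul_self L) v hQσ)]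
    simp only [Homeomorph.toMeasurableEquiv_coe, he₀, hΘ, hφ]
  -- ★ `splitMiddleRows_of_leviRow_reading`
  obtain ⟨g, hg₁, hg₂⟩ := splitMiddleRows_of_leviRow_reading (Fp L) L v hπ w₀ hπw μK (Pred := fun x => x ∈ siegelDeltaLoc L e dV hdV dW hdW v)
    (fun y => swSectionTensorLoc L e dV hdV dW hdW eW e' dV' hdV' v (localSplittingDatumCM L v μ (3 + 3) (gramR_isSymm L e' dV hdV (tensorFrame L dW eW dV') (tensorFrame_real L dW hdW eW dV' hdV')) hT₀d (hermD_eq_map_gramD L e' dV hdV (tensorFrame L dW eW dV') (tensorFrame_real L dW hdW eW dV' hdV')) χ hχ).localSplitting m₀ Φk (y)) (fun y => swSectionTensorLoc L e dV hdV dW hdW eW e' dV' hdV' v (localSplittingDatumCM L v μ (3 + 3) (gramR_isSymm L e' dV hdV (tensorFrame L dW eW dV') (tensorFrame_real L dW hdW eW dV' hdV')) hT₀d (hermD_eq_map_gramD L e' dV hdV (tensorFrame L dW eW dV') (tensorFrame_real L dW hdW eW dV' hdV')) χ hχ).localSplitting m₀ Φk1 (y)) w₁ c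
    (fun x => (((chiDet (Fp L) L (IsCMField.complexConj L) v (3 + 3) (fun w' : PlacesOver L v => (χ.localComponent w'.1)⁻¹)
        (tensorEmbLoc L e dV hdV dW hdW eW e' dV' hdV' v (mF x)))⁻¹ : ℂˣ) : ℂ) * ((modSqrt (glEquiv (BF x)) : ℂ))⁻¹)
    (fun x => Ψf (-(im (quadraticLocalEquiv L v (IsCMField.complexConj L) (complexConj_imagUnit L) (imagUnit_ne_zero L)).toLinearEquiv.toAddEquiv
      ((gramS (Fp L) L v 2 (gramR L e dV hdV dW hdW) * tF x) i₀ i₀))))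
    (fun x _ => hΨc _) (D := (1 : w₀.1.adicCompletion L)) (by rw [map_one]) kd
    (fun x j => blkD (matA (Fp L) L (IsCMField.complexConj L) v 2 (mF x)⁻¹) j i₀ w₀)
    (fun x j => conjLocal L (IsCMField.complexConj L) v (blkD (matA (Fp L) L (IsCMField.complexConj L) v 2 (mF x)⁻¹) j i₀) w₀)
    n' n'' hn'le hn'eq hn''le hn''eq (Measure.pi fun _ : Fin (3 + 3) => μ) e₀.toMeasurableEquiv hcR.ne' hμR
    (hrow Φk kd hreadk) (hrow Φk1 (kd + 1) hreadk1)
  refine ⟨g, c, hc, hg₁, fun x hx => ?_⟩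
  rw [hg₂ x hx, hqK]

end Tensor

end Summit.HodgeConjecture.HodgeConjecture.Cruxes.HLiu418.K2LiuSplitWitnessMiddleProfileRowOfLeviRow

end
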